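import Literature.Geometry.Riemannian.BamlerFCompactness
import Literature.Geometry.Riemannian.MetricFlowFConvergenceWithinExists
import HarnessLib

/-!
# 𝔽-precompactness of Ricci flows WITHIN a correspondence (Bamler 2023, §7.1, Thm. 7.6 for a
# finite interval, from Cor. 7.5 and Thm. 6.4)

R. Bamler, *Compactness theory of the space of super Ricci flows*, Invent. Math. 233 (2023), §7.1,
Thm. 7.6 (arXiv v1 Thm. 157): after passing to a subsequence there are a limit and "a
correspondence `ℭ` between the metric flows `𝒳ⁱ`, `i ∈ ℕ ∪ {∞}`, such that … we even have normal
𝔽-convergence within `ℭ`" when the interval is finite. The source's own route to this conclusion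
from the `d_𝔽`-compactness (Thm. 7.4 / Cor. 7.5) is Thm. 6.4 (arXiv v1 Thm. 128: 𝔽-convergence
implies 𝔽-convergence within a correspondence). In the tree the latter is PROVED
(`exists_familyCorrespondence_fConvergesWithin`), so the within-a-correspondence form of the
precompactness of compact Ricci flows follows from the typed fact `bamler_FCompactness_ricciFlow`
(Cor. 7.5 form): `exists_subseq_familyCorrespondence_of_bamler_FCompactness` — a subsequence, an
`H_m`-concentrated limit pair, ONE family correspondence over `[a, T]` (indexed by `Option ℕ`,
`none` = the limit) and `FConvergesWithin` (Def. 6.1) of the pairs of the flows along the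
subsequence. Conditional only on the fact; no new facts.

## References

* R. H. Bamler, *Compactness theory of the space of super Ricci flows*, Invent. Math. 233 (2023),
  1121–1277, §7.1 Cor. 7.5, Thm. 7.6; §6.2 Thm. 6.4. [Bamler2023]
-/

noncomputable section

open Set Filter
open scoped Manifold ContDiff Topology ENNReal NNReal

namespace Literature.Geometry.Riemannian

open Lorentzian Lorentzian.PseudoRiemannianMetric

/-- **Precompactness of compact Ricci flows within ONE correspondence** (Bamler 2023, Thm. 7.6 for
the finite interval `[a, T]`, `J = ∅`, obtained as in the source from Cor. 7.5 — here the typed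
fact `bamler_FCompactness_ricciFlow` — and Thm. 6.4, `exists_familyCorrespondence_fConvergesWithin`):
every sequence of Ricci flows of smooth families of Riemannian metrics on closed connected
`m`-manifolds over `[a, T]` with base points has a subsequence `φ`, an `H_m`-concentrated metric
flow pair `P∞` over `[a, T]` and a family correspondence `ℭ` between the flows of the pairs
`ricciFlowMetricFlowPair … (x (φ i))` and of `P∞` such that the pairs 𝔽-converge to `P∞` WITHIN `ℭ`
(uniformly over `J = ∅`). [cite: Bamler2023, §7.1, Thm. 7.6; Cor. 7.5; §6.2, Thm. 6.4] -/
theorem exists_subseq_familyCorrespondence_of_bamler_FCompactness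
    (hF : bamler_FCompactness_ricciFlow) (m : ℕ) (hm : 0 < m) (a T : ℝ) (haT : a < T)
    (M : ℕ → Type) [∀ k, TopologicalSpace (M k)]
    [∀ k, ChartedSpace (EuclideanSpace ℝ (Fin m)) (M k)]
    [∀ k, IsManifold 𝓘(ℝ, EuclideanSpace ℝ (Fin m)) ∞ (M k)] [∀ k, T2Space (M k)]
    [∀ k, CompactSpace (M k)] [∀ k, SecondCountableTopology (M k)]
    [∀ k, MeasurableSpace (M k)] [∀ k, BorelSpace (M k)] [∀ k, ConnectedSpace (M k)]
    (h : ∀ k, ℝ → PseudoRiemannianMetric 𝓘(ℝ, EuclideanSpace ℝ (Fin m)) ∞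
      (EuclideanSpace ℝ (Fin m)) (TangentSpace 𝓘(ℝ, EuclideanSpace ℝ (Fin m)) : M k → Type _))
    (cov : ∀ k, ℝ → CovariantDerivative 𝓘(ℝ, EuclideanSpace ℝ (Fin m))
      (EuclideanSpace ℝ (Fin m)) (TangentSpace 𝓘(ℝ, EuclideanSpace ℝ (Fin m)) : M k → Type _))
    (hflow : ∀ k, IsRicciFlow (h k) (cov k) (Icc a T))
    (hh : ∀ k, IsContMDiffFamilyOn ∞ (h k) univ) (hR : ∀ k s, (h k s).IsRiemannian)
    (x : ∀ k, M k) :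
    ∃ φ : ℕ → ℕ, StrictMono φ ∧ ∃ P : MetricFlowPair.{0} (Icc a T),
      P.flow.IsHConcentrated (MetricFlow.concentrationConst m) ∧
      ∃ ℭ : MetricFlow.FamilyCorrespondence
          (fun o : Option ℕ ↦ (o.elim P
            (fun i ↦ ricciFlowMetricFlowPair (hh (φ i)) (hR (φ i)) (hflow (φ i)) haT (x (φ i)))).flow)
          (Icc a T),
        MetricFlowPair.FConvergesWithin
          (fun i ↦ ricciFlowMetricFlowPair (hh (φ i)) (hR (φ i)) (hflow (φ i)) haT (x (φ i))) P ℭ ∅ := by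
  obtain ⟨φ, hφ, P, hP, hT⟩ := hF m hm a T haT M h cov hflow hh hR x
  obtain ⟨ℭ, -, hℭ⟩ := exists_familyCorrespondence_fConvergesWithin
    (fun i ↦ ricciFlowMetricFlowPair (hh (φ i)) (hR (φ i)) (hflow (φ i)) haT (x (φ i))) P ∅
    (fun _ ↦ empty_subset _) (empty_subset _) hT
  exact ⟨φ, hφ, P, hP, ℭ, hℭ⟩

end Literature.Geometry.Riemannian

end
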